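import Literature.NumberTheory.Sieve.SmoothRoughDecomposition
import HarnessLib

/-!
# Rough values of a linear polynomial as rough numbers in a residue class

Topic `Literature/NumberTheory/Sieve`. Everything here is PROVED (no definitions, no named facts).
For integers `α ≥ 1`, `β` and thresholds `T`, `x`, the map `n ↦ α n + β` is a bijection from
`{1 ≤ n ≤ x : α n + β > 0 and no prime p < T divides α n + β}` onto the `T`-rough numbers
`m ≤ α x + β` (`roughIcc T ⌊α x + β⌋`, `SmoothRoughDecomposition.lean`) in the class
`m ≡ β (mod α)` with `m ≥ α + β` (`LinearRoughValues.card_eq_card_filter`); hence the count of such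
`n` is the class count `#{m ∈ roughIcc T ⌊α x + β⌋ : m ≡ β (mod α)}` up to an error of at most
`(α + β)⁺` (`LinearRoughValues.abs_card_sub_card_filter_le`).  This is the (trivial) dictionary
between "values of `aX + b` free of small primes" and "rough numbers in the progression `b mod a`"
used for the linear case of rough-value laws of Bateman–Horn systems.

## References

* H. Halberstam, H.-E. Richert, *Sieve Methods* (1974), §1.4, Example 3 (polynomial sequences on
  a progression). [HalberstamRichert1974]
-/

open Finset

namespace Literature.NumberTheory.Sieve

namespace LinearRoughValues

/-- The class `β mod α` as a natural residue: for `α ≥ 1`,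
`m ≡ (β mod α) (mod α)` iff `m mod α = β mod α` in `ℤ`. [folklore] -/
theorem modEq_toNat_iff {α β : ℤ} (hα : 0 < α) (m : ℕ) :
    m ≡ (β % α).toNat [MOD α.toNat] ↔ (m : ℤ) % α = β % α := by
  have hαto : ((α.toNat : ℕ) : ℤ) = α := Int.toNat_of_nonneg hα.le
  have hc0 : 0 ≤ β % α := Int.emod_nonneg β hα.ne'
  have hcto : (((β % α).toNat : ℕ) : ℤ) = β % α := Int.toNat_of_nonneg hc0
  have hclt : (β % α).toNat < α.toNat := by
    have : β % α < α := Int.emod_lt_of_pos β hα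
    omega
  rw [Nat.ModEq, Nat.mod_eq_of_lt hclt]
  constructor
  · intro h
    have h' := congrArg (Nat.cast : ℕ → ℤ) h
    rwa [Int.natCast_mod, hαto, hcto] at h'
  · intro h
    have h' : ((m % α.toNat : ℕ) : ℤ) = (((β % α).toNat : ℕ) : ℤ) := by
      rw [Int.natCast_mod, hαto, hcto]; exact h
    exact_mod_cast h'

/-- **Rough values of `α n + β` are the rough numbers of the class `β mod α`.** For `α ≥ 1`,
`n ↦ α n + β` is a bijection from `{1 ≤ n ≤ x : α n + β > 0, p prime, p < T ⇒ p ∤ α n + β}` onto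
`{m ∈ roughIcc T ⌊α x + β⌋ : m ≡ β (mod α), m ≥ α + β}` (inverse `m ↦ (m − β)/α`). [folklore] -/
theorem card_eq_card_filter (α β : ℤ) (hα : 0 < α) (T x : ℕ) :
    #((Icc 1 x).filter (fun n : ℕ => 0 < α * n + β ∧
        ∀ p ∈ range T, p.Prime → ¬ ((p : ℤ) ∣ α * n + β))) =
      #(((roughIcc T ⌊(α : ℝ) * x + β⌋₊).filter (· ≡ (β % α).toNat [MOD α.toNat])).filter
          (fun m : ℕ => α + β ≤ (m : ℤ))) := by
  refine Finset.card_bij' (fun n _ => (α * n + β).toNat) (fun m _ => (((m : ℤ) - β) / α).toNat)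
    ?_ ?_ ?_ ?_
  · -- `α n + β` lies in the class set
    intro n hn
    rw [mem_filter, mem_Icc] at hn
    obtain ⟨⟨hn1, hnx⟩, hpos, hprime⟩ := hn
    have hmZ : (((α * n + β).toNat : ℕ) : ℤ) = α * n + β := Int.toNat_of_nonneg hpos.le
    rw [mem_filter, mem_filter, mem_roughIcc, modEq_toNat_iff hα]
    refine ⟨⟨⟨⟨by omega, ?_⟩, fun p hp hpm => ?_⟩, ?_⟩, ?_⟩
    · refine Nat.le_floor ?_
      have hnx' : (n : ℤ) ≤ x := by exact_mod_cast hnx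
      have h1 : (((α * n + β).toNat : ℕ) : ℤ) ≤ α * x + β := by rw [hmZ]; nlinarith
      exact_mod_cast h1
    · by_contra hlt
      push Not at hlt
      refine hprime p (mem_range.mpr hlt) hp ?_
      rw [← hmZ]
      exact_mod_cast hpm
    · rw [hmZ, add_comm, Int.add_mul_emod_self_left]
    · rw [hmZ]
      have hn1' : (1 : ℤ) ≤ n := by exact_mod_cast hn1
      nlinarith
  · -- `(m − β)/α` lies in the value set
    intro m hm
    rw [mem_filter, mem_filter, mem_roughIcc, modEq_toNat_iff hα] at hm
    obtain ⟨⟨⟨⟨hm1, hmX⟩, hrough⟩, hcl⟩, hge⟩ := hm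
    have hdvd : α ∣ (m : ℤ) - β := (Int.ModEq.symm hcl).dvd
    set k := ((m : ℤ) - β) / α with hk
    have hk' : α * k = m - β := Int.mul_ediv_cancel' hdvd
    have hk1 : 1 ≤ k := by
      by_contra h
      push Not at h
      have : α * k ≤ 0 := by nlinarith
      omega
    have hkto : ((k.toNat : ℕ) : ℤ) = k := Int.toNat_of_nonneg (by omega)
    have hXr0 : (0 : ℝ) ≤ (α : ℝ) * x + β := by
      by_contra h
      push Not at h
      rw [Nat.floor_of_nonpos h.le] at hmX
      omega
    have hmR : ((m : ℕ) : ℝ) ≤ (α : ℝ) * x + β :=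
      le_trans (by exact_mod_cast hmX) (Nat.floor_le hXr0)
    have hmZ : (m : ℤ) ≤ α * x + β := by exact_mod_cast hmR
    have hkx : k ≤ x := le_of_mul_le_mul_left (by rw [hk']; linarith) hα
    rw [mem_filter, mem_Icc]
    refine ⟨⟨by omega, by omega⟩, ?_, fun p hp hpP hdiv => ?_⟩
    · rw [hkto, hk']; omega
    · rw [hkto, hk', sub_add_cancel] at hdiv
      have h1 : T ≤ p := hrough p hpP (by exact_mod_cast hdiv)
      exact absurd (mem_range.mp hp) (not_lt.mpr h1)
  · -- left inverse
    intro n hn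
    rw [mem_filter] at hn
    have hmZ : (((α * n + β).toNat : ℕ) : ℤ) = α * n + β := Int.toNat_of_nonneg hn.2.1.le
    simp only [hmZ, add_sub_cancel_right, Int.mul_ediv_cancel_left _ hα.ne', Int.toNat_natCast]
  · -- right inverse
    intro m hm
    rw [mem_filter, mem_filter, modEq_toNat_iff hα] at hm
    obtain ⟨⟨-, hcl⟩, hge⟩ := hm
    have hdvd : α ∣ (m : ℤ) - β := (Int.ModEq.symm hcl).dvd
    have hk' : α * (((m : ℤ) - β) / α) = m - β := Int.mul_ediv_cancel' hdvd
    have hk0 : 0 ≤ ((m : ℤ) - β) / α := by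
      by_contra h
      push Not at h
      have : α * (((m : ℤ) - β) / α) < 0 := by nlinarith
      omega
    simp only [Int.toNat_of_nonneg hk0, hk', sub_add_cancel, Int.toNat_natCast]

/-- **The count of rough values of `α n + β` is a class count of rough numbers up to `O(1)`.** For
`α ≥ 1`: `|#{1 ≤ n ≤ x : α n + β > 0, p < T prime ⇒ p ∤ α n + β} − #{m ∈ roughIcc T ⌊α x + β⌋ : m ≡ β (mod α)}| ≤ (α + β)⁺`
(the rough `m` of the class not of the form `α n + β`, `n ≥ 1`, are those below `α + β`). [folklore] -/
theorem abs_card_sub_card_filter_le (α β : ℤ) (hα : 0 < α) (T x : ℕ) :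
    |(#((Icc 1 x).filter (fun n : ℕ => 0 < α * n + β ∧
          ∀ p ∈ range T, p.Prime → ¬ ((p : ℤ) ∣ α * n + β))) : ℝ) -
        #((roughIcc T ⌊(α : ℝ) * x + β⌋₊).filter (· ≡ (β % α).toNat [MOD α.toNat]))| ≤
      (α + β).toNat := by
  rw [card_eq_card_filter α β hα T x]
  set F := (roughIcc T ⌊(α : ℝ) * x + β⌋₊).filter (· ≡ (β % α).toNat [MOD α.toNat]) with hF
  have hsplit := card_filter_add_card_filter_not (s := F) (fun m : ℕ => α + β ≤ (m : ℤ))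
  have hsmall : #(F.filter (fun m : ℕ => ¬ (α + β ≤ (m : ℤ)))) ≤ (α + β).toNat := by
    calc _ ≤ #(range (α + β).toNat) := card_le_card fun m hm => by
          rw [mem_filter] at hm
          rw [mem_range]
          omega
      _ = (α + β).toNat := card_range _
  have h1 : (#(F.filter (fun m : ℕ => α + β ≤ (m : ℤ))) : ℝ) - #F =
      -(#(F.filter (fun m : ℕ => ¬ (α + β ≤ (m : ℤ)))) : ℝ) := by
    rw [← hsplit]; push_cast; ring
  rw [h1, abs_neg, Nat.abs_cast]
  exact_mod_cast hsmall

end LinearRoughValues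

end Literature.NumberTheory.Sieve
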